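import Mathlib
import Summits.ValiantsHypothesis.ValiantsHypothesis.Theorems.MonotoneRestorationMixingScalePolyScale
import HarnessLib

/-!
# Line `mixing-scale` (crux `OrbitRestorationQP`, stmt-ValiantsHypothesis-18293): the NON-RESIDUAL CHAIN, assembled Theorems-side

Route MonotoneRestoration, line `mixing-scale` (val-idea-12).  Namespace `Summit.ValiantsHypothesis.ValiantsHypothesis.Theorems.OrbitRestorationQPMixingScale`.

Every registered stub of the line except the declared residual is now a LANDED theorem (M2 `stub_almostInvariantTerms` p601705, M3
`stub_orbitClassSums` p601193, M4a `essStableAlt` p602355, M4b `spanOneUAlt` p602629, M4c `stub_polyScaleStructure` p604312, M5 `growingFanin`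
p603096; FACT A p600616; vocabulary p600419/p601910/p602843).  This file records the two compositions the skeleton states
(`growingFanin_of`, `sigmaPiSigmaRestorationQP_of`) in their final Theorems-side form:

* `growingFaninRestoration_of` — the NEW RUNG `GrowingFaninRestoration` (restoration for growing top fan-in `κ(n) ≲ (n / log n)^{1/7}`)
  from exactly three inputs BY NAME: the Literature facts `alternatingProductMixing` (Gowers 2008 / Nikolov–Pyber 2011; UNPROVED in the tree,
  reduced to `JamesKerber1981_thm_2_5_15` by val-lit's `alternatingProductMixing_of_minDegree`) and `depthThree_rankBound` (Saxena–Seshadhri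
  2013 Thm 5; UNPROVED in the tree), and A₁ = `PiSigmaValue` (the OPEN `ΠΣ` sub-rung of the line of record);
* `productDepthRestorationQP_one_of_residual` — the rung `ProductDepthRestorationQP (fun _ => 1)` of the product-depth ladder from the same
  three inputs AND the declared residual `GrowingFaninResidual` (never staffed) as the one explicit extra hypothesis.

Honest framing: these are CONDITIONAL results; the crux `OrbitRestorationQP` (stmt-18293) is NOT closed and VP ≠ VNP is NOT proved or moved.
[cite: Gowers2008, Thm 3.3; NikolovPyber2011, Cor. 2; SaxenaSeshadhri2013, Theorem 5; KarninShpilka2009, §3]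
-/

noncomputable section

open Literature.Computability.AlgebraicComplexity Literature.GroupTheory.QuasirandomGroups

-- `Summit.ValiantsHypothesis.ValiantsHypothesis.…` is the tree's single-conjunct layout (Sub = Summit).
set_option linter.dupNamespace false

namespace Summit.ValiantsHypothesis.ValiantsHypothesis.Theorems.OrbitRestorationQPMixingScale

open OrbitRestorationQPDepthThreeRung

/-- **THE NEW RUNG FROM THE NAMED INPUTS** (the skeleton's `growingFanin_of`, every stub discharged): product mixing in `𝔄_n` + the
depth-three rank bound + A₁ ⇒ restoration for growing top fan-in. [cite: Gowers2008, Thm 3.3; SaxenaSeshadhri2013, Theorem 5] -/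
theorem growingFaninRestoration_of (hmix : alternatingProductMixing) (hRB : depthThree_rankBound) (hA1 : PiSigmaValue) :
    GrowingFaninRestoration :=
  growingFaninRestoration_of_facts hmix hRB hA1

/-- **THE RUNG `ProductDepthRestorationQP 1` MODULO THE DECLARED RESIDUAL** (the skeleton's `sigmaPiSigmaRestorationQP_of` with the residual
`GrowingFaninResidual` — never staffed — as an explicit hypothesis instead of a sorried stub). [folklore] -/
theorem productDepthRestorationQP_one_of_residual (hres : GrowingFaninResidual) (hmix : alternatingProductMixing)
    (hRB : depthThree_rankBound) (hA1 : PiSigmaValue) : ProductDepthRestorationQP (fun _ => 1) :=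
  hres (growingFaninRestoration_of hmix hRB hA1)

end Summit.ValiantsHypothesis.ValiantsHypothesis.Theorems.OrbitRestorationQPMixingScale

end
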